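import Literature.MathematicalPhysics.QuantumFieldTheory.Balaban1983to89.B9Eq33CovDerivVector
import Literature.MathematicalPhysics.QuantumFieldTheory.Balaban1983to89.B9Eq349BlockDistanceWeight

/-!
# `Balaban1983to89.B9Eq33CovDerivLocalLetter` — T. Bałaban, *Propagators for lattice gauge theories in a background field*, Commun. Math. Phys. **99**
# (1985) 389–434 [Balaban1985BackgroundPropagators] (3.3) pp. 390–391 (the covariant derivative *«(D^η_{U₀}A)(b) = η⁻¹(R(U₀(b))A(b₊) − A(b₋))»*) and (3.8)
# p. 392 (its adjoint *«(D*A)(x) = Σ_μ η⁻¹(R(U(x, x − ηe_μ))A(x − ηe_μ, x) − A(x, x + ηe_μ))»*) against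
# Thm 3.1 (3.42) p. 397 and (3.153) p. 426 (the words `G₁ − G₁DRD*G₁ − …` in which `D` is a factor): **THE COVARIANT DERIVATIVE CARRIES THE LOCAL LETTER (L)
# OF (3.42) AT EVERY RATE, AND SO DOES ITS ADJOINT `D*` — both have range ONE bond: for `g` supported in the block `Δ(v)` with `‖g(y)‖ ≤ F`, `(Dg)(b) = 0` unless `b₋` or `b₊` lies in `Δ(v)`,
# and `‖(Dg)(b)‖ ≤ ‖c‖·(M_R + 1)·F` always; hence `‖(Dg)(b)‖ ≤ ‖c‖(M_R+1)e^{κ}·e^{−κ·d_m(Δ(b₋), v)}·F` for every `κ ≥ 0`; likewise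
# `‖(D*A)(y)‖ ≤ ‖c‖·d(M_S+1)e^{κ}·e^{−κ·d_m(Δ(y), v)}·F` for bond functions supported over `Δ(v)`** — the finite-range instances of this
# lineage's `B9Eq347LocalLetterAlgebra.local_of_range`, typed directly on the cell's `B9Eq33CovDerivVector.covDeriv` so that it is fileable while that module
# waits for the build lane (pub-balaban NE9 owner's SUP-NORM PROGRAMME plan v10 §6 OPEN (4): the letters of the finite-range factors of (3.123)∕(3.153))

statement-level skeleton of published theorems with citation tags; proofs where landed; nothing here is a claim about the Yang–Mills mass gap

CITATION HEADER (lean-in-tree rule).  Audit cell `pub-balaban`, sub-cell `t4`, BINDER row NE9; filed by NE9 crux-team LEAF PROVER 03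
(`b2b-balaban-t4-ne9-formalise-leaf-03`, gen 71).  Composed BY NAME: the OWNER lineage's `B9Eq33CovDerivVector.covDeriv` ∕ `covDeriv_apply` ((3.3) as a linear
map on plain functions; `covDiv` ∕ `covDiv_apply` for (3.8)), ne9-leaf-01's `B9Eq349BlockDistanceWeight.mul_tdist_blockCoord_sub_le_tdist` ∕ `tdist_bpos_btgt_le_one` (a bond's ends lie in
equal or adjacent blocks).  Sources READ (renders `…1985-cmp99-background-propagators-p002∕p003∕p009`): [Balaban1985BackgroundPropagators] pp. 390–391 (3.3),
p. 392 (3.8), p. 397 (3.42).  NOTHING printed is asserted: the transporters `R`, `S` are arbitrary linear data with displayed bounds `M_R`, `M_S`.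

WHAT IS PROVED (sorry-free; proof lane — no `def`; [folklore]).
* §1 (any torus `T_P`, any normed fibre): **`norm_covDeriv_apply_le`** (`‖(Dg)(b)‖ ≤ ‖c‖·(M_R+1)·sup‖g‖` under `‖R(b)w‖ ≤ M_R‖w‖`, `0 ≤ M_R`);
  **`covDeriv_apply_eq_zero_of_ends`** (`(Dg)(b) = 0` when `g` vanishes at both ends of `b`); **`norm_covDiv_apply_le`** (`‖(D*A)(y)‖ ≤ ‖c‖·d(M_S+1)·sup‖A‖`);
  **`covDiv_apply_eq_zero_of_ends`** (`(D*A)(y) = 0` when `A` vanishes on the `2d` bonds at `y`).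
* §2 (fine torus `T_{(L·m)}` over unit blocks, `π = blockCoord L m` on sites, `b ↦ blockCoord L m b₋` on bonds): **`tdist_blockCoord_bpos_btgt_le_one`** (the
  two ends of a bond lie in blocks at unit distance `≤ 1`); **`local_covDeriv`** — the letter (L)(D; ‖c‖(M_R+1)e^{κ}, κ) for every `κ ≥ 0`, in the shape of
  `B9Eq347GlobalFromLocal`∕`B9Eq347LocalLetterAlgebra` (`X = TSite`, `X′ = Bond`, `T = covDeriv c R`, profiles `≡ 1`); **`local_covDiv`** — the letter
  (L)(D*; ‖c‖d(M_S+1)e^{κ}, κ) for bond functions supported over one block (`X = Bond`, `X′ = TSite`, `T = covDiv c S`).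
HONEST SCOPE.  Two factors' letters; `M_R = M_S = 1` for unitary transports (the chain's (T)); no estimate of print.  NOT (3.42), NOT NE9 (cell pub-balaban: NE9 NOT
PRINTED ∕ NOT PROVED; «NE9 ⇐ the named binders»; row WALLED ON A MODEL (O-NE9-1; #5 UNRULED); spine PROVED 0∕9; rung (B)+1 on a finite T⁴ — NOT infinite
volume, NOT mass gap, NOT Clay; HONEST DEPENDENCY: continuum YM on T⁴ ⇐ BetaPertH ∧ nine spine estimates (0/9 proved); BetaPertH ⇐ (D1) ∧ (D4) ∧ CAP+tail;
G-an2-4 gates asym, D1 and NE2/3/4).  NEW file importing `B9Eq33CovDerivVector` + `B9Eq349BlockDistanceWeight` (both built); nothing modified.  Net new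
unproved facts: 0.
-/

noncomputable section

namespace Literature.MathematicalPhysics.QuantumFieldTheory.Balaban1983to89.B9Eq33CovDerivLocalLetter

open B4Sect5Torus (TSite tdist tdist_nonneg tdist_self tdist_symm)
open B9SectCLatticeCarrier (Bond bpos btgt unshift shift_unshift)
open B9Eq319QprimeTorus (fineP blockCoord)
open B9Eq33CovDerivVector (covDeriv covDeriv_apply covDiv covDiv_apply)
open B9Eq349BlockDistanceWeight (mul_tdist_blockCoord_sub_le_tdist tdist_bpos_btgt_le_one)

/-! ## §1 Size and support of the covariant derivative -/

section Basic

variable {d : ℕ} {Pd : Fin d → ℕ} {𝕜 : Type*} [NontriviallyNormedField 𝕜] {V : Type*} [NormedAddCommGroup V] [NormedSpace 𝕜 V]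

/-- **`‖(Dg)(b)‖ ≤ ‖c‖·(M_R + 1)·sup‖g‖`**: (3.3) has two terms, the transported one weighted by `M_R`. [folklore]
[cite: Balaban1985BackgroundPropagators, (3.3) pp.390-391] -/
theorem norm_covDeriv_apply_le (c : 𝕜) (R : Bond d Pd → V →ₗ[𝕜] V) {MR : ℝ} (hMR : 0 ≤ MR) (hR : ∀ b w, ‖R b w‖ ≤ MR * ‖w‖)
    (g : TSite d Pd → V) {F : ℝ} (hgF : ∀ y, ‖g y‖ ≤ F) (b : Bond d Pd) :
    ‖covDeriv c R g b‖ ≤ ‖c‖ * (MR + 1) * F := by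
  rw [covDeriv_apply, norm_smul]
  calc ‖c‖ * ‖R b (g (btgt b)) - g (bpos b)‖ ≤ ‖c‖ * (‖R b (g (btgt b))‖ + ‖g (bpos b)‖) :=
        mul_le_mul_of_nonneg_left (norm_sub_le _ _) (norm_nonneg c)
    _ ≤ ‖c‖ * (MR * F + F) := by
        refine mul_le_mul_of_nonneg_left (add_le_add ?_ (hgF _)) (norm_nonneg c)
        exact (hR b _).trans (mul_le_mul_of_nonneg_left (hgF _) hMR)
    _ = ‖c‖ * (MR + 1) * F := by ring

/-- **`(Dg)(b) = 0` WHEN `g` VANISHES AT BOTH ENDS OF THE BOND** — `D` has range one bond. [folklore] [cite: Balaban1985BackgroundPropagators, (3.3) pp.390-391] -/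
theorem covDeriv_apply_eq_zero_of_ends (c : 𝕜) (R : Bond d Pd → V →ₗ[𝕜] V) (g : TSite d Pd → V) (b : Bond d Pd)
    (hlo : g (bpos b) = 0) (hhi : g (btgt b) = 0) : covDeriv c R g b = 0 := by
  rw [covDeriv_apply, hlo, hhi, map_zero, sub_zero, smul_zero]

/-- **`‖(D*A)(y)‖ ≤ ‖c‖·d·(M_S + 1)·sup‖A‖`**: (3.8) sums `2d` bond values at a site, `d` of them transported (weight `M_S`). [folklore]
[cite: Balaban1985BackgroundPropagators, (3.8) p.392] -/
theorem norm_covDiv_apply_le (c : 𝕜) (S : Bond d Pd → V →ₗ[𝕜] V) {MS : ℝ} (hMS : 0 ≤ MS) (hS : ∀ b w, ‖S b w‖ ≤ MS * ‖w‖)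
    (A : Bond d Pd → V) {F : ℝ} (hAF : ∀ b, ‖A b‖ ≤ F) (y : TSite d Pd) :
    ‖covDiv c S A y‖ ≤ ‖c‖ * (d * (MS + 1)) * F := by
  rw [covDiv_apply, norm_smul]
  have hterm : ∀ μ : Fin d, ‖S (unshift μ y, μ) (A (unshift μ y, μ)) - A (y, μ)‖ ≤ (MS + 1) * F := fun μ =>
    calc ‖S (unshift μ y, μ) (A (unshift μ y, μ)) - A (y, μ)‖ ≤ ‖S (unshift μ y, μ) (A (unshift μ y, μ))‖ + ‖A (y, μ)‖ := norm_sub_le _ _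
      _ ≤ MS * F + F := add_le_add ((hS _ _).trans (mul_le_mul_of_nonneg_left (hAF _) hMS)) (hAF _)
      _ = (MS + 1) * F := by ring
  calc ‖c‖ * ‖∑ μ, (S (unshift μ y, μ) (A (unshift μ y, μ)) - A (y, μ))‖
      ≤ ‖c‖ * ∑ μ : Fin d, (MS + 1) * F :=
        mul_le_mul_of_nonneg_left ((norm_sum_le _ _).trans (Finset.sum_le_sum fun μ _ => hterm μ)) (norm_nonneg c)
    _ = ‖c‖ * (d * (MS + 1)) * F := by rw [Finset.sum_const, Finset.card_univ, Fintype.card_fin, nsmul_eq_mul]; ring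

/-- **`(D*A)(y) = 0` WHEN `A` VANISHES ON THE `2d` BONDS AT `y`** — `D*` has range one bond. [folklore] [cite: Balaban1985BackgroundPropagators, (3.8) p.392] -/
theorem covDiv_apply_eq_zero_of_ends (c : 𝕜) (S : Bond d Pd → V →ₗ[𝕜] V) (A : Bond d Pd → V) (y : TSite d Pd)
    (h0 : ∀ μ, A (y, μ) = 0) (h1 : ∀ μ, A (unshift μ y, μ) = 0) : covDiv c S A y = 0 := by
  rw [covDiv_apply]
  simp [h0, h1]


end Basic

/-! ## §2 The letter (L) for `D` on the fine torus over unit blocks -/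

section Lattice

variable {d : ℕ} {L : ℕ} [NeZero L] {m : Fin d → ℕ} {𝕜 : Type*} [NontriviallyNormedField 𝕜] {V : Type*} [NormedAddCommGroup V] [NormedSpace 𝕜 V]

/-- **THE TWO ENDS OF A BOND LIE IN BLOCKS AT UNIT-LATTICE DISTANCE `≤ 1`**: `d_m(Δ(b₋), Δ(b₊)) ≤ 1` (from `L·d_m(πx,πx′) − (L−1) ≤ d(x,x′) ≤ 1`).
[folklore] [cite: Balaban1985Averaging, (1)–(2) p.17; Balaban1985BackgroundPropagators, (3.49) p.399] -/
theorem tdist_blockCoord_bpos_btgt_le_one (hm : ∀ i, 1 ≤ m i) (b : Bond d (fineP L m)) :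
    tdist m (blockCoord L m (bpos b)) (blockCoord L m (btgt b)) ≤ 1 := by
  have hL : (1 : ℝ) ≤ L := by exact_mod_cast Nat.one_le_iff_ne_zero.mpr (NeZero.ne L)
  have hP : ∀ i, 1 ≤ fineP L m i := fun i =>
    Nat.one_le_iff_ne_zero.mpr (Nat.mul_ne_zero (NeZero.ne L) (by have := hm i; omega))
  have h1 := mul_tdist_blockCoord_sub_le_tdist (L := L) (m := m) hm (bpos b) (btgt b)
  have h2 := tdist_bpos_btgt_le_one hP b
  have h3 : (L : ℝ) * tdist m (blockCoord L m (bpos b)) (blockCoord L m (btgt b)) ≤ (L : ℝ) * 1 := by linarith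
  exact le_of_mul_le_mul_left h3 (by linarith)

/-- **THE COVARIANT DERIVATIVE CARRIES THE LETTER (L) AT EVERY RATE `κ ≥ 0`** (fine torus `T_{(L·m)}`, blocks `Δ(v)` of side `L`, output bonds indexed by
the block of their base point): for `g` supported in `Δ(v)` with `‖g(y)‖ ≤ F` and every bond `b`,
`‖(Dg)(b)‖ ≤ ‖c‖·(M_R + 1)·e^{κ}·e^{−κ·d_m(Δ(b₋), v)}·F` — `D` vanishes unless an end of `b` lies in `Δ(v)`, and then `d_m(Δ(b₋), v) ≤ 1`.  This is the
hypothesis shape `hloc` of `B9Eq347GlobalFromLocal` ∕ the input shape of `B9Eq347LocalLetterAlgebra.local_comp` with `X = TSite`, `X′ = Bond`,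
`π′ b = blockCoord L m b₋`, `T = covDeriv c R`, profile `≡ 1`. [folklore] [cite: Balaban1985BackgroundPropagators, (3.3) pp.390-391, Thm 3.1 (3.42) p.397, (3.153) p.426] -/
theorem local_covDeriv (hm : ∀ i, 1 ≤ m i) (c : 𝕜) (R : Bond d (fineP L m) → V →ₗ[𝕜] V) {MR : ℝ} (hMR : 0 ≤ MR)
    (hR : ∀ b w, ‖R b w‖ ≤ MR * ‖w‖)
    {κ : ℝ} (hκ : 0 ≤ κ) (v : TSite d m) (g : TSite d (fineP L m) → V) (F : ℝ) (hgv : ∀ y, blockCoord L m y ≠ v → g y = 0)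
    (hgF : ∀ y, ‖g y‖ ≤ F) (b : Bond d (fineP L m)) :
    ‖covDeriv c R g b‖ ≤ ‖c‖ * (MR + 1) * Real.exp κ * Real.exp (-(κ * tdist m (blockCoord L m (bpos b)) v)) * F := by
  have hF : 0 ≤ F := (norm_nonneg _).trans (hgF (bpos b))
  have hsup := norm_covDeriv_apply_le c R hMR hR g hgF b
  have hMR1 : 0 ≤ ‖c‖ * (MR + 1) * F := mul_nonneg (mul_nonneg (norm_nonneg c) (by linarith)) hF
  -- the exponential compensation: `1 ≤ e^{κ}·e^{−κ·D}` whenever `D ≤ 1`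
  have hcomp : ∀ {D : ℝ}, D ≤ 1 → ‖c‖ * (MR + 1) * F ≤ ‖c‖ * (MR + 1) * Real.exp κ * Real.exp (-(κ * D)) * F := fun {D} hD => by
    have h1 : (1 : ℝ) ≤ Real.exp κ * Real.exp (-(κ * D)) := by
      rw [← Real.exp_add]
      exact Real.one_le_exp (by nlinarith [mul_le_mul_of_nonneg_left hD hκ])
    calc ‖c‖ * (MR + 1) * F = ‖c‖ * (MR + 1) * F * 1 := (mul_one _).symm
      _ ≤ ‖c‖ * (MR + 1) * F * (Real.exp κ * Real.exp (-(κ * D))) := mul_le_mul_of_nonneg_left h1 hMR1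
      _ = ‖c‖ * (MR + 1) * Real.exp κ * Real.exp (-(κ * D)) * F := by ring
  by_cases hlo : blockCoord L m (bpos b) = v
  · -- the base point's block IS `v`: distance `0`
    rw [hlo, tdist_self]
    exact hsup.trans (hcomp zero_le_one)
  · by_cases hhi : blockCoord L m (btgt b) = v
    · -- the tip's block is `v`: the base block is adjacent
      have hD : tdist m (blockCoord L m (bpos b)) v ≤ 1 := by
        rw [← hhi]; exact tdist_blockCoord_bpos_btgt_le_one hm b
      exact hsup.trans (hcomp hD)
    · -- neither end in `Δ(v)`: `(Dg)(b) = 0`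
      rw [covDeriv_apply_eq_zero_of_ends c R g b (hgv _ hlo) (hgv _ hhi), norm_zero]
      exact mul_nonneg (mul_nonneg (mul_nonneg (mul_nonneg (norm_nonneg _) (by linarith)) (Real.exp_nonneg _)) (Real.exp_nonneg _)) hF

/-- **THE ADJOINT DERIVATIVE `D*` CARRIES THE LETTER (L) AT EVERY RATE `κ ≥ 0`** (bond functions supported in the block of their base point; output sites):
for `A` with `A(b) = 0` unless `Δ(b₋) = Δ(v)`, `‖A(b)‖ ≤ F`, and every site `y`: `‖(D*A)(y)‖ ≤ ‖c‖·d(M_S+1)·e^{κ}·e^{−κ·d_m(Δ(y), v)}·F` — the `2d` bonds at `y`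
have base points in `Δ(y)` or in an adjacent block. The `hloc`∕`h₂` shape of `B9Eq347GlobalFromLocal` ∕ `B9Eq347LocalLetterAlgebra.local_comp` with
`X = Bond`, `X′ = TSite`, `π b = blockCoord L m b₋`, `π′ = blockCoord L m`, `T = covDiv c S`. [folklore]
[cite: Balaban1985BackgroundPropagators, (3.8) p.392, Thm 3.1 (3.42) p.397, (3.153) p.426] -/
theorem local_covDiv (hm : ∀ i, 1 ≤ m i) (c : 𝕜) (S : Bond d (fineP L m) → V →ₗ[𝕜] V) {MS : ℝ} (hMS : 0 ≤ MS)
    (hS : ∀ b w, ‖S b w‖ ≤ MS * ‖w‖) {κ : ℝ} (hκ : 0 ≤ κ) (v : TSite d m) (A : Bond d (fineP L m) → V) (F : ℝ)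
    (hAv : ∀ b, blockCoord L m (bpos b) ≠ v → A b = 0) (hAF : ∀ b, ‖A b‖ ≤ F) (y : TSite d (fineP L m)) :
    ‖covDiv c S A y‖ ≤ ‖c‖ * (d * (MS + 1)) * Real.exp κ * Real.exp (-(κ * tdist m (blockCoord L m y) v)) * F := by
  rcases Nat.eq_zero_or_pos d with hd | hd
  · subst hd
    rw [covDiv_apply]
    simp
  have hF : 0 ≤ F := (norm_nonneg _).trans (hAF (y, ⟨0, hd⟩))
  have hsup := norm_covDiv_apply_le c S hMS hS A hAF y
  have hK0 : 0 ≤ ‖c‖ * (d * (MS + 1)) * F := mul_nonneg (mul_nonneg (norm_nonneg c) (by positivity)) hF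
  have hcomp : ∀ {D : ℝ}, D ≤ 1 → ‖c‖ * (d * (MS + 1)) * F ≤ ‖c‖ * (d * (MS + 1)) * Real.exp κ * Real.exp (-(κ * D)) * F :=
    fun {D} hD => by
    have h1 : (1 : ℝ) ≤ Real.exp κ * Real.exp (-(κ * D)) := by
      rw [← Real.exp_add]
      exact Real.one_le_exp (by nlinarith [mul_le_mul_of_nonneg_left hD hκ])
    calc ‖c‖ * (d * (MS + 1)) * F = ‖c‖ * (d * (MS + 1)) * F * 1 := (mul_one _).symm
      _ ≤ ‖c‖ * (d * (MS + 1)) * F * (Real.exp κ * Real.exp (-(κ * D))) := mul_le_mul_of_nonneg_left h1 hK0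
      _ = ‖c‖ * (d * (MS + 1)) * Real.exp κ * Real.exp (-(κ * D)) * F := by ring
  by_cases hy : blockCoord L m y = v
  · rw [hy, tdist_self]
    exact hsup.trans (hcomp zero_le_one)
  · by_cases hex : ∃ μ, blockCoord L m (unshift μ y) = v
    · obtain ⟨μ, hμ⟩ := hex
      have hD : tdist m (blockCoord L m y) v ≤ 1 := by
        have h : tdist m (blockCoord L m (unshift μ y)) (blockCoord L m (B9SectCLatticeCarrier.shift μ (unshift μ y))) ≤ 1 :=
          tdist_blockCoord_bpos_btgt_le_one (L := L) (m := m) hm (unshift μ y, μ)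
        rw [shift_unshift] at h
        rw [← hμ, tdist_symm hm]
        exact h
      exact hsup.trans (hcomp hD)
    · simp only [not_exists] at hex
      rw [covDiv_apply_eq_zero_of_ends c S A y (fun μ => hAv (y, μ) hy) (fun μ => hAv (unshift μ y, μ) (hex μ)), norm_zero]
      exact mul_nonneg (mul_nonneg (mul_nonneg (mul_nonneg (norm_nonneg _) (by positivity)) (Real.exp_nonneg _))
        (Real.exp_nonneg _)) hF


end Lattice

end Literature.MathematicalPhysics.QuantumFieldTheory.Balaban1983to89.B9Eq33CovDerivLocalLetter

end
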